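import Summits.QuantumFields.QCD.Theorems.ExtinctionBuildsQCD.Negative.ExtinctIntegrable

/-!
# `WindowExtinction` (SD⁺, stmt-QuantumFields-18063) from the clean-edge cut of the pricing programme

Support file for the crux `WindowExtinction` of route `SpectralDefectExtinction` (line lead c3, 2026-08-17).
Theorems-level (importable) form of the ledger edge by which this crux is expected to close: the route's
pricing mechanism `TipPricing → WegnerEstimate → WindowExtinction` (support `ExtinctionOfPricing`, proved)
composed with the crux-strategist's typed split of `TipPricing` (crux workfile
`Cruxes/TipPricing/TipPricingSplit.lean`, `tipPricing_of_subs`, whose two binders are copied VERBATIM below so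
that the future route items of that split plug in by name):

* TRUNK ("tight clean edge"): one mass-scaling, asymptotically scaling Wilson regularisation of minimal volume
  growth (`L_k ^ q ≤ a_k⁻¹ ^ (q+1)` eventually, every `q ≥ 1`), on the physical branch, with a threshold `M₀`
  above which EXTINCT (a) (real modes of the massless `r = 1` Wilson–Dirac operator below every running mass,
  `≤ ε` per scheme torus on all tori at least the scheme's) and TIGHT⁺ (verbatim) hold;
* LEAF ("coercivity pricing"): `WegnerEstimate →` at every such clean tight edge the full EXTINCT clause
  (a)+(b) of `WindowExtinction` holds above some `M₁ ≥ M₀` with some window constant `c > 0`.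

`windowExtinction_of_cleanEdgeSplit : TRUNK → LEAF → WegnerEstimate → WindowExtinction` is pure logic over the
verbatim clause texts (cap exponent `p = 2` read off minimal growth at `q = 1`; threshold raised to `M₁`;
TIGHT⁺ restricted to probes `M > M₁`).  It records, importably, that the crux is the conclusion of
TRUNK ∧ LEAF ∧ `WegnerEstimate` (items: the split children of stmt-QuantumFields-8967, and stmt-QuantumFields-8966).
No definitions, no named facts, no `sorry`.
-/

open scoped BigOperators Topology
open Filter MeasureTheory
open Literature.MathematicalPhysics.QuantumLattice Literature.MathematicalPhysics.QuantumFieldTheory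
  Literature.Probability.LatticeModels
open Summit.QuantumFields.QCD.Theses.SpectralDefectExtinction
open Summit.QuantumFields.QCD.Theorems.ExtinctionBuildsQCD.Negative

namespace Summit.QuantumFields.QCD.Cruxes.WindowExtinction.CleanEdgeSplit

/-- **`WindowExtinction` from the clean-edge cut.**  TRUNK (a minimal-growth, branched, mass- and
asymptotically scaling regularisation whose line is a clean tight edge: EXTINCT (a) ∧ TIGHT⁺ above `M₀`)
→ LEAF (`WegnerEstimate` prices the Hermitian coercivity window at every clean tight edge: full EXTINCT
(a)+(b) above some `M₁ ≥ M₀`, some `c > 0`) → `WegnerEstimate` → `WindowExtinction`.  The binders are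
verbatim those of the strategist's split glue `tipPricing_of_subs` (crux stmt-QuantumFields-8967); the proof
is bookkeeping: feed the trunk's witness to the leaf, take cap exponent `2` from minimal growth at `q = 1`,
raise the threshold to `M₁` and restrict TIGHT⁺ to probes above `M₁`. -/
theorem windowExtinction_of_cleanEdgeSplit
    (hT : ∀ Nf : ℕ, (Nf = 2 ∨ Nf = 3) → ∃ reg : QCDRegularisation Nf, reg.HasMassScaling ∧ (reg.scheme 0 0 0).HasAsymptoticScaling ∧ (∀ q : ℕ, 0 < q → ∀ᶠ k : ℕ in Filter.atTop, (reg.L k : ℝ) ^ q ≤ (reg.a k)⁻¹ ^ (q + 1)) ∧ (∀ᶠ k : ℕ in Filter.atTop, -1 < reg.mcrit k) ∧ ∃ M₀ : ℝ, 0 ≤ M₀ ∧ ∀ m : Fin Nf → ℝ, (∀ f, M₀ < m f) → (∀ ε : ℝ, 0 < ε → ∀ᶠ k : ℕ in Filter.atTop, ∀ S : ℕ, reg.L k ≤ S → (∫ U, (∑ f : Fin Nf, (Multiset.countP (fun z : ℂ => z.im = 0 ∧ z.re < -(reg.mcrit k + reg.a k * m f / reg.Zm k)) (wilsonDirac (fundamentalRep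 (Fin 3)) U 0 1).charpoly.roots : ℝ)) * ∏ f : Fin Nf, ‖fermionDet (wilsonDirac (fundamentalRep (Fin 3)) U (reg.mcrit k + reg.a k * m f / reg.Zm k) 1)‖ ∂(wilsonMeasure (d := 4) (L := 2 * S + 1) (fundamentalRep (Fin 3)) (reg.β k))) / (∫ U, ∏ f : Fin Nf, ‖fermionDet (wilsonDirac (fundamentalRep (Fin 3)) U (reg.mcrit k + reg.a k * m f / reg.Zm k) 1)‖ ∂(wilsonMeasure (d := 4) (L := 2 * S + 1) (fundamentalRep (Fin 3)) (reg.β k))) ≤ ε * ((2 * S + 1 : ℝ) / (2 * reg.L k + 1)) ^ 4) ∧ (∃ η : ℝ, 0 < η ∧ ∀ M : ℝ, M₀ < M → ∀ᶠ k : ℕ in Filter.atTop, max 1 (η * (reg.a k * (2 * reg.L k + 1 : ℝ)) ^ 2) ≤ (∫ U, (|(Multiset.countP (fun z : ℂ => z.re < 0) (spinorLift gammaFive * wilsonDirac (fundamentalRep (Fin 3)) U (reg.mcrit k - reg.a k * M / reg.Zm k) 1).charpoly.roots : ℝ) - 6 * (2 * reg.L k + 1 : ℝ) ^ 4|) * ∏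 f : Fin Nf, ‖fermionDet (wilsonDirac (fundamentalRep (Fin 3)) U (reg.mcrit k + reg.a k * m f / reg.Zm k) 1)‖ ∂(wilsonMeasure (d := 4) (L := 2 * reg.L k + 1) (fundamentalRep (Fin 3)) (reg.β k))) / (∫ U, ∏ f : Fin Nf, ‖fermionDet (wilsonDirac (fundamentalRep (Fin 3)) U (reg.mcrit k + reg.a k * m f / reg.Zm k) 1)‖ ∂(wilsonMeasure (d := 4) (L := 2 * reg.L k + 1) (fundamentalRep (Fin 3)) (reg.β k)))))
    (hB : WegnerEstimate → ∀ Nf : ℕ, (Nf = 2 ∨ Nf = 3) → ∀ reg : QCDRegularisation Nf, reg.HasMassScaling → (reg.scheme 0 0 0).HasAsymptoticScaling → (∀ q : ℕ, 0 < q → ∀ᶠ k : ℕ in Filter.atTop, (reg.L k : ℝ) ^ q ≤ (reg.a k)⁻¹ ^ (q + 1)) → (∀ᶠ k : ℕ in Filter.atTop, -1 < reg.mcrit k) → ∀ M₀ : ℝ, 0 ≤ M₀ → (∀ m : Fin Nf → ℝ, (∀ f, M₀ < m f) → (∀ ε : ℝ, 0 < ε → ∀ᶠ k : ℕ in Filter.atTop,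 ∀ S : ℕ, reg.L k ≤ S → (∫ U, (∑ f : Fin Nf, (Multiset.countP (fun z : ℂ => z.im = 0 ∧ z.re < -(reg.mcrit k + reg.a k * m f / reg.Zm k)) (wilsonDirac (fundamentalRep (Fin 3)) U 0 1).charpoly.roots : ℝ)) * ∏ f : Fin Nf, ‖fermionDet (wilsonDirac (fundamentalRep (Fin 3)) U (reg.mcrit k + reg.a k * m f / reg.Zm k) 1)‖ ∂(wilsonMeasure (d := 4) (L := 2 * S + 1) (fundamentalRep (Fin 3)) (reg.β k))) / (∫ U, ∏ f : Fin Nf, ‖fermionDet (wilsonDirac (fundamentalRep (Fin 3)) U (reg.mcrit k + reg.a k * m f / reg.Zm k) 1)‖ ∂(wilsonMeasure (d := 4) (L := 2 * S + 1) (fundamentalRep (Fin 3)) (reg.β k))) ≤ ε * ((2 * S + 1 : ℝ) / (2 * reg.L k + 1)) ^ 4) ∧ (∃ η : ℝ, 0 < η ∧ ∀ M : ℝ, M₀ < M → ∀ᶠ k : ℕ in Filter.atTop, max 1 (η * (reg.a k * (2 * reg.L k + 1 : ℝ)) ^ 2) ≤ (∫ U, (|(Multiset.countP (fun z : ℂ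 => z.re < 0) (spinorLift gammaFive * wilsonDirac (fundamentalRep (Fin 3)) U (reg.mcrit k - reg.a k * M / reg.Zm k) 1).charpoly.roots : ℝ) - 6 * (2 * reg.L k + 1 : ℝ) ^ 4|) * ∏ f : Fin Nf, ‖fermionDet (wilsonDirac (fundamentalRep (Fin 3)) U (reg.mcrit k + reg.a k * m f / reg.Zm k) 1)‖ ∂(wilsonMeasure (d := 4) (L := 2 * reg.L k + 1) (fundamentalRep (Fin 3)) (reg.β k))) / (∫ U, ∏ f : Fin Nf, ‖fermionDet (wilsonDirac (fundamentalRep (Fin 3)) U (reg.mcrit k + reg.a k * m f / reg.Zm k) 1)‖ ∂(wilsonMeasure (d := 4) (L := 2 * reg.L k + 1) (fundamentalRep (Fin 3)) (reg.β k))))) → ∃ M₁ : ℝ, M₀ ≤ M₁ ∧ ∃ c : ℝ, 0 < c ∧ ∀ m : Fin Nf → ℝ, (∀ f, M₁ < m f) → (∀ ε : ℝ, 0 < ε → ∀ᶠ k : ℕ in Filter.atTop, ∀ S : ℕ, reg.L k ≤ S → (∫ U, ((∑ f : Fin Nf, ((Multiset.countP (fun z : ℂ => z.im = 0 ∧ z.re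 < -(reg.mcrit k + reg.a k * m f / reg.Zm k)) (wilsonDirac (fundamentalRep (Fin 3)) U 0 1).charpoly.roots : ℝ) + (Multiset.countP (fun z : ℂ => |z.re| < c * (reg.a k * m f / reg.Zm k)) (spinorLift gammaFive * wilsonDirac (fundamentalRep (Fin 3)) U (reg.mcrit k + reg.a k * m f / reg.Zm k) 1).charpoly.roots : ℝ)))) * ∏ f : Fin Nf, ‖fermionDet (wilsonDirac (fundamentalRep (Fin 3)) U (reg.mcrit k + reg.a k * m f / reg.Zm k) 1)‖ ∂(wilsonMeasure (d := 4) (L := 2 * S + 1) (fundamentalRep (Fin 3)) (reg.β k))) / (∫ U, ∏ f : Fin Nf, ‖fermionDet (wilsonDirac (fundamentalRep (Fin 3)) U (reg.mcrit k + reg.a k * m f / reg.Zm k) 1)‖ ∂(wilsonMeasure (d := 4) (L := 2 * S + 1) (fundamentalRep (Fin 3)) (reg.β k))) ≤ ε * ((2 * S + 1 : ℝ) / (2 * reg.L k + 1)) ^ 4))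
    (hW : WegnerEstimate) : WindowExtinction := by
  intro Nf hNf
  obtain ⟨reg, hms, has, hgr, hbr, M₀, hM₀, hTm⟩ := hT Nf hNf
  obtain ⟨M₁, hM₀₁, c, hc, hE⟩ := hB hW Nf hNf reg hms has hgr hbr M₀ hM₀ hTm
  refine ⟨reg, hms, has, ⟨2, ?_⟩, hbr, M₁, le_trans hM₀ hM₀₁, c, hc, fun m hm => ⟨hE m hm, ?_⟩⟩
  · filter_upwards [hgr 1 one_pos] with k hk
    simpa using hk
  · have hm' : ∀ f, M₀ < m f := fun f => lt_of_le_of_lt hM₀₁ (hm f)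
    obtain ⟨η, hη, hT'⟩ := (hTm m hm').2
    exact ⟨η, hη, fun M hM => hT' M (lt_of_le_of_lt hM₀₁ hM)⟩

/-- **The trunk is necessary up to the volume clause: `WindowExtinction` gives a clean tight edge on its own
(capped) scheme torus.**  Projection of SD⁺ onto EXTINCT (a) ∧ TIGHT⁺ (clause (b) and the window constant
dropped; the cap kept as filed, `∃ p`).  Together with `windowExtinction_of_cleanEdgeSplit` this brackets the
crux between the capped and the minimal-growth forms of the clean tight edge, modulo the Wegner leaf. -/
theorem cleanTightEdge_capped_of_windowExtinction (h : WindowExtinction) :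
    ∀ Nf : ℕ, (Nf = 2 ∨ Nf = 3) → ∃ reg : QCDRegularisation Nf, reg.HasMassScaling ∧ (reg.scheme 0 0 0).HasAsymptoticScaling ∧ (∃ p : ℕ, ∀ᶠ k : ℕ in Filter.atTop, (reg.L k : ℝ) ≤ (reg.a k)⁻¹ ^ p) ∧ (∀ᶠ k : ℕ in Filter.atTop, -1 < reg.mcrit k) ∧ ∃ M₀ : ℝ, 0 ≤ M₀ ∧ ∀ m : Fin Nf → ℝ, (∀ f, M₀ < m f) → (∀ ε : ℝ, 0 < ε → ∀ᶠ k : ℕ in Filter.atTop, ∀ S : ℕ, reg.L k ≤ S → (∫ U, (∑ f : Fin Nf, (Multiset.countP (fun z : ℂ => z.im = 0 ∧ z.re < -(reg.mcrit k + reg.a k * m f / reg.Zm k)) (wilsonDirac (fundamentalRep (Fin 3)) U 0 1).charpoly.roots : ℝ)) * ∏ f : Fin Nf, ‖fermionDet (wilsonDirac (fundamentalRep (Fin 3)) U (reg.mcrit k + reg.a k * m f / reg.Zm k) 1)‖ ∂(wilsonMeasure (d := 4) (L := 2 * S + 1) (fundamentalRep (Fin 3)) (reg.β k))) / (∫ U,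 ∏ f : Fin Nf, ‖fermionDet (wilsonDirac (fundamentalRep (Fin 3)) U (reg.mcrit k + reg.a k * m f / reg.Zm k) 1)‖ ∂(wilsonMeasure (d := 4) (L := 2 * S + 1) (fundamentalRep (Fin 3)) (reg.β k))) ≤ ε * ((2 * S + 1 : ℝ) / (2 * reg.L k + 1)) ^ 4) ∧ (∃ η : ℝ, 0 < η ∧ ∀ M : ℝ, M₀ < M → ∀ᶠ k : ℕ in Filter.atTop, max 1 (η * (reg.a k * (2 * reg.L k + 1 : ℝ)) ^ 2) ≤ (∫ U, (|(Multiset.countP (fun z : ℂ => z.re < 0) (spinorLift gammaFive * wilsonDirac (fundamentalRep (Fin 3)) U (reg.mcrit k - reg.a k * M / reg.Zm k) 1).charpoly.roots : ℝ) - 6 * (2 * reg.L k + 1 : ℝ) ^ 4|) * ∏ f : Fin Nf, ‖fermionDet (wilsonDirac (fundamentalRep (Fin 3)) U (reg.mcrit k + reg.a k * m f / reg.Zm k) 1)‖ ∂(wilsonMeasure (d := 4) (L := 2 * reg.L k + 1) (fundamentalRep (Fin 3)) (reg.β k))) / (∫ U, ∏ f : Fin Nf, ‖fermionDet (wilsonDirac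 (fundamentalRep (Fin 3)) U (reg.mcrit k + reg.a k * m f / reg.Zm k) 1)‖ ∂(wilsonMeasure (d := 4) (L := 2 * reg.L k + 1) (fundamentalRep (Fin 3)) (reg.β k)))) := by
  intro Nf hNf
  obtain ⟨reg, hMS, hAS, hCap, hBr, M₀, hM₀, c, _hc, H⟩ := h Nf hNf
  refine ⟨reg, hMS, hAS, hCap, hBr, M₀, hM₀, fun m hm => ⟨fun ε hε => ?_, (H m hm).2⟩⟩
  filter_upwards [(H m hm).1 ε hε] with k hk S hS
  refine le_trans (div_le_div_of_nonneg_right (integral_mono ?_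
    (integrable_extinctIntegrand reg c k m (reg.β k)) fun U => ?_)
    (integral_nonneg fun U => Finset.prod_nonneg fun f _ => norm_nonneg _)) (hk S hS)
  · -- integrability of the clause-(a) integrand: bounded measurable counts times the continuous weight
    refine integrable_mul_weight (fun f => reg.mcrit k + reg.a k * m f / reg.Zm k) (reg.β k)
      (Finset.measurable_sum _ fun f _ =>
        measurable_from_nat.comp (measurable_signDefectCount (-(reg.mcrit k + reg.a k * m f / reg.Zm k))))
      (C := ∑ _f : Fin Nf, (Fintype.card (QuarkIdx (2 * S + 1)) : ℝ)) (fun U => ?_)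
    rw [abs_of_nonneg (Finset.sum_nonneg fun f _ => by positivity)]
    exact Finset.sum_le_sum fun f _ => by exact_mod_cast countP_roots_charpoly_le_card _ _
  · -- pointwise: dropping the non-negative clause-(b) counts
    refine mul_le_mul_of_nonneg_right (Finset.sum_le_sum fun f _ => ?_)
      (Finset.prod_nonneg fun f _ => norm_nonneg _)
    exact le_add_of_nonneg_right (Nat.cast_nonneg _)

end Summit.QuantumFields.QCD.Cruxes.WindowExtinction.CleanEdgeSplit
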